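import Summits.ValiantsHypothesis.ValiantsHypothesis.Theses.GirthSidon

/-!
# Route GirthSidon — support item `SwallowOfFormal` (A7 typed Puiseux glue, piece 2)

Route `route-ValiantsHypothesis-GirthSidon`, item `stmt-ValiantsHypothesis-21121`
(`Summit.ValiantsHypothesis.ValiantsHypothesis.Theses.GirthSidon.SwallowOfFormal`):

  `FormalSwallowForcesShortRelation → PuiseuxTransfer → SwallowForcesShortRelation`.

The formal cancellation crux (`stmt-ValiantsHypothesis-6536`) together with the numeric-to-Puiseux
transfer for monomial curves (`PuiseuxTransfer`, `stmt-ValiantsHypothesis-21118`, proved in the tree by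
`Summit.ValiantsHypothesis.ValiantsHypothesis.Theorems.stub_monomialNumericToPuiseux`) gives the
numeric cancellation crux (`stmt-ValiantsHypothesis-6535`).

Proof (bookkeeping, ~10 lines): given `m ≥ m₀`, `d : Fin m → ℕ`, `s` with `s^10 ≤ m^9` and a
non-`(s,2)`-elusive monomial curve `x ↦ (x^{d_i})`, `PuiseuxTransfer` yields `N ≥ 1`, a quadratic
`Γ : Fin m → ℂ[y_1..y_s]` and Laurent series `y` with `Γ_i(y) = t^{N·d_i}`; apply
`FormalSwallowForcesShortRelation` to the SCALED exponents `N·d` (same `m`, `s`) to obtain multisets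
`S ≠ T` of size `≤ 30` with `Σ_S N·d = Σ_T N·d`, and cancel `N > 0`
(`Multiset.sum_map_mul_left`, `Nat.eq_of_mul_eq_mul_left`).

This registers crux 6536 as a typed sufficient line for crux 6535 (6536 ⟹ 6535 given the proved
transfer); the converse is not claimed. Honest framing: glue only; both cruxes remain OPEN; nothing
here bears on VP ≠ VNP.
-/

-- Sub = Summit layout duplicates the namespace component
set_option linter.dupNamespace false

namespace Summit.ValiantsHypothesis.ValiantsHypothesis.Theorems

open Summit.ValiantsHypothesis.ValiantsHypothesis.Theses.GirthSidon

/-- **A7 glue, piece 2** (item `stmt-ValiantsHypothesis-21121`, route decl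
`Theses.GirthSidon.SwallowOfFormal` verbatim): the formal cancellation crux
`FormalSwallowForcesShortRelation` and the numeric-to-Puiseux transfer `PuiseuxTransfer` imply the
numeric cancellation crux `SwallowForcesShortRelation`. Proof: scale the exponents by the
ramification index `N ≥ 1` of the Puiseux transfer, apply the formal crux to `N·d`, and cancel `N`
from the resulting short additive relation. -/
theorem swallowOfFormal_proof :
    Summit.ValiantsHypothesis.ValiantsHypothesis.Theses.GirthSidon.SwallowOfFormal := by
  unfold SwallowOfFormal
  intro hF hP
  obtain ⟨m₀, hm₀⟩ := hF
  refine ⟨m₀, fun m hm d s hs hne => ?_⟩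
  obtain ⟨N, Γ, y, hN, hΓ, hy⟩ := hP m s d hne
  obtain ⟨S, T, hST, hS, hT, hsum⟩ := hm₀ m hm (fun i => N * d i) s hs Γ y hΓ (fun i => hy i)
  refine ⟨S, T, hST, hS, hT, ?_⟩
  rw [Multiset.sum_map_mul_left, Multiset.sum_map_mul_left] at hsum
  exact Nat.eq_of_mul_eq_mul_left hN hsum

end Summit.ValiantsHypothesis.ValiantsHypothesis.Theorems
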